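import Summits.CriticalPhenomena.PercolationContinuityZ3.Theorems.NearLinearTwoClusterDecay.Negative.GluedCriterion
import Literature.Probability.Percolation.HalfSpaceBGN
import Literature.Probability.Percolation.CriticalContinuityProofs
import HarnessLib

/-!
# The critical two-cluster DICHOTOMY at every bounded aspect (vdBvE programme, brick V4 = Lemma 6 at `p_c`)

Negative-side structure for the crux `NearLinearTwoClusterDecay` (stmt-CriticalPhenomena-5785), line
`critical-orange-peeling`, lead seat c2.  Bond percolation on `ℤ³`; `cross(n,m)` = "`Λ(n)` joined to
`∂ⁱⁿΛ(m)` inside `Λ(m)`", `A₂(k,m)` = the crux's two-cluster event (two sites of `Λ(k)` joined inside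
`Λ(m)` to `∂ⁱⁿΛ(m)` but not to each other).

* `twoCluster_dichotomy` (registered stub): GIVEN the same-`p` finite-size criterion with uniqueness
  gluing (the landed `gluedCriterion`, taken verbatim as hypothesis: `P_p(cross(n,16Mn)ᶜ) + P_p(A₂(4n,4Mn)) < ε(M)`
  at ONE scale forces `θ(p) > 0`), at `p = p_c(ℤ³)` the sum can be small at NO scale:
  `∀ M ≥ 1, ∃ ε > 0, ∀ n ≥ 1, ε ≤ P_{p_c}(cross(n,16Mn)ᶜ) + P_{p_c}(A₂(4n,4Mn))`.  Proof: both events are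
  local (determined by the pairs inside `Λ(16Mn)`), so the sum is continuous in `p`; were it `< ε` at `p_c`
  it would be `< ε` at some `p < p_c` (`p_c > 0`), giving `θ(p) > 0` below `p_c` — absurd.
* `critTwoCluster_dichotomy` : the unconditional corollary (hypothesis discharged by `gluedCriterion`).

This is van den Berg–van Engelenburg's Lemma 6 (arXiv:2009.13337) in one-arm currency: at every scale,
EITHER the one-arm crossing of aspect `16M` is non-certain OR two in-box-distinct crossing clusters of
aspect `M` have probability `≥ ε(M)/2`.  (The sibling crux stmt-4446 landed the case `M = 2` as
`UniquenessDichotomy.ratioBlocking_add_twoSpanning_ge`.)  In any `θ(p_c) > 0` world the first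
alternative dies (`crossing_tendsto_one_of_theta_pos`), pinning `P_{p_c}(A₂(4n,4Mn)) ≥ ε/2` for all large
`n` — brick V6; unconditionally the square-root trick converts the first alternative into two-cluster
positivity at a larger scale (Prop. 2) — the lead's assembly.
-/

noncomputable section

namespace Summit.CriticalPhenomena.PercolationContinuityZ3.Theorems.NearLinearTwoClusterDecay.Negative

open MeasureTheory Filter Topology
open Literature.Probability.LatticeModels Literature.Probability.Percolation
open Literature.Probability.Percolation.DCT16

namespace Dichotomy

/-- Configurations agreeing on the pairs inside `Λ(m)` agree on every `{x ⟷ y in Λ(m)}`. -/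
theorem openConnIn_box_congr {m : ℕ} {ω ω' : BondConfig (Site 3)}
    (h : ω ∩ (↑(box 3 m).sym2 : Set (Sym2 (Site 3))) = ω' ∩ ↑(box 3 m).sym2) (x y : Site 3) :
    ω ∈ openConnIn (↑(box 3 m) : Set (Site 3)) x y ↔ ω' ∈ openConnIn (↑(box 3 m) : Set (Site 3)) x y :=
  (determinedBy_iff _ _).1
    (determinedBy_openConnIn (↑(box 3 m) : Set (Site 3)) x y (K := (↑(box 3 m).sym2 : Set (Sym2 (Site 3))))
      (by rw [Finset.coe_sym2])) ω ω' h

/-- The no-crossing event `cross(n,m)ᶜ` is determined by the pairs inside `Λ(m)`. -/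
theorem determinedBy_noCross (n m : ℕ) :
    DeterminedBy {ω : BondConfig (Site 3) | ¬ ∃ x ∈ box 3 n, ∃ y ∈ innerBoundary (zdGraph 3) (box 3 m),
        ω ∈ openConnIn (↑(box 3 m) : Set (Site 3)) x y} (↑(box 3 m).sym2 : Set (Sym2 (Site 3))) := by
  rw [determinedBy_iff]
  intro ω ω' h
  simp only [Set.mem_setOf_eq, openConnIn_box_congr h]

/-- The two-cluster event `A₂(k,m)` is determined by the pairs inside `Λ(m)`. -/
theorem determinedBy_twoCluster (k m : ℕ) :
    DeterminedBy {ω : BondConfig (Site 3) | ∃ x ∈ box 3 k, ∃ x' ∈ box 3 k,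
        ∃ y ∈ innerBoundary (zdGraph 3) (box 3 m), ∃ y' ∈ innerBoundary (zdGraph 3) (box 3 m),
          ω ∈ openConnIn (↑(box 3 m) : Set (Site 3)) x y ∧
          ω ∈ openConnIn (↑(box 3 m) : Set (Site 3)) x' y' ∧
          ω ∉ openConnIn (↑(box 3 m) : Set (Site 3)) x x'} (↑(box 3 m).sym2 : Set (Sym2 (Site 3))) := by
  rw [determinedBy_iff]
  intro ω ω' h
  simp only [Set.mem_setOf_eq, openConnIn_box_congr h]

/-- `p ↦ P_p(cross(n,m)ᶜ) + P_p(A₂(k,m'))` is continuous on `[0,1]` (two local events). -/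
theorem continuous_sum (n m k m' : ℕ) :
    Continuous fun p : unitInterval =>
      (bondPercolation (zdGraph 3) p).real
          {ω : BondConfig (Site 3) | ¬ ∃ x ∈ box 3 n, ∃ y ∈ innerBoundary (zdGraph 3) (box 3 m),
            ω ∈ openConnIn (↑(box 3 m) : Set (Site 3)) x y} +
        (bondPercolation (zdGraph 3) p).real
          {ω : BondConfig (Site 3) | ∃ x ∈ box 3 k, ∃ x' ∈ box 3 k,
            ∃ y ∈ innerBoundary (zdGraph 3) (box 3 m'), ∃ y' ∈ innerBoundary (zdGraph 3) (box 3 m'),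
              ω ∈ openConnIn (↑(box 3 m') : Set (Site 3)) x y ∧
              ω ∈ openConnIn (↑(box 3 m') : Set (Site 3)) x' y' ∧
              ω ∉ openConnIn (↑(box 3 m') : Set (Site 3)) x x'} :=
  (continuous_bondPercolation_real_of_determinedBy (zdGraph 3) (determinedBy_noCross n m)).add
    (continuous_bondPercolation_real_of_determinedBy (zdGraph 3) (determinedBy_twoCluster k m'))

end Dichotomy

/-- **Registered stub `twoCluster_dichotomy` (vdBvE programme V4 — Lemma 6 of arXiv:2009.13337 at
`p_c`, one-arm currency).** If the same-`p` finite-size criterion with uniqueness gluing holds (the landed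
`gluedCriterion`, verbatim as hypothesis), then for every `M ≥ 1` there is `ε > 0` such that at `p_c(ℤ³)`,
for EVERY `n ≥ 1`, `ε ≤ P(Λ(n) ↮ ∂ⁱⁿΛ(16Mn) in Λ(16Mn)) + P(A₂(4n, 4Mn))`.
[cite: VandenbergVanengelenburg2022, Lemma 6] -/
theorem twoCluster_dichotomy
    (hcrit : ∀ M : ℕ, 1 ≤ M → ∃ ε : ℝ, 0 < ε ∧ ∀ (p : unitInterval) (n : ℕ), 1 ≤ n →
      (bondPercolation (zdGraph 3) p).real
          {ω | ¬ ∃ x ∈ box 3 n, ∃ y ∈ innerBoundary (zdGraph 3) (box 3 (16 * M * n)),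
            ω ∈ openConnIn (↑(box 3 (16 * M * n)) : Set (Site 3)) x y} +
        (bondPercolation (zdGraph 3) p).real
          {ω | ∃ x ∈ box 3 (4 * n), ∃ x' ∈ box 3 (4 * n),
            ∃ y ∈ innerBoundary (zdGraph 3) (box 3 (4 * M * n)),
            ∃ y' ∈ innerBoundary (zdGraph 3) (box 3 (4 * M * n)),
              ω ∈ openConnIn (↑(box 3 (4 * M * n)) : Set (Site 3)) x y ∧
              ω ∈ openConnIn (↑(box 3 (4 * M * n)) : Set (Site 3)) x' y' ∧
              ω ∉ openConnIn (↑(box 3 (4 * M * n)) : Set (Site 3)) x x'} < ε →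
      0 < theta (zdGraph 3) 0 p) :
    ∀ M : ℕ, 1 ≤ M → ∃ ε : ℝ, 0 < ε ∧ ∀ n : ℕ, 1 ≤ n →
      ε ≤ (bondPercolation (zdGraph 3) (criticalProbI 3)).real
          {ω | ¬ ∃ x ∈ box 3 n, ∃ y ∈ innerBoundary (zdGraph 3) (box 3 (16 * M * n)),
            ω ∈ openConnIn (↑(box 3 (16 * M * n)) : Set (Site 3)) x y} +
        (bondPercolation (zdGraph 3) (criticalProbI 3)).real
          {ω | ∃ x ∈ box 3 (4 * n), ∃ x' ∈ box 3 (4 * n),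
            ∃ y ∈ innerBoundary (zdGraph 3) (box 3 (4 * M * n)),
            ∃ y' ∈ innerBoundary (zdGraph 3) (box 3 (4 * M * n)),
              ω ∈ openConnIn (↑(box 3 (4 * M * n)) : Set (Site 3)) x y ∧
              ω ∈ openConnIn (↑(box 3 (4 * M * n)) : Set (Site 3)) x' y' ∧
              ω ∉ openConnIn (↑(box 3 (4 * M * n)) : Set (Site 3)) x x'} := by
  intro M hM
  obtain ⟨ε, hε, hεM⟩ := hcrit M hM
  refine ⟨ε, hε, fun n hn => ?_⟩
  by_contra hlt
  -- continuity in `p` moves the small sum slightly BELOW `p_c` (one-sided openness, inlined)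
  obtain ⟨p, hp, hpε⟩ : ∃ p : unitInterval, (p : ℝ) < criticalProbI 3 ∧
      (bondPercolation (zdGraph 3) p).real
          {ω | ¬ ∃ x ∈ box 3 n, ∃ y ∈ innerBoundary (zdGraph 3) (box 3 (16 * M * n)),
            ω ∈ openConnIn (↑(box 3 (16 * M * n)) : Set (Site 3)) x y} +
        (bondPercolation (zdGraph 3) p).real
          {ω | ∃ x ∈ box 3 (4 * n), ∃ x' ∈ box 3 (4 * n),
            ∃ y ∈ innerBoundary (zdGraph 3) (box 3 (4 * M * n)),
            ∃ y' ∈ innerBoundary (zdGraph 3) (box 3 (4 * M * n)),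
              ω ∈ openConnIn (↑(box 3 (4 * M * n)) : Set (Site 3)) x y ∧
              ω ∈ openConnIn (↑(box 3 (4 * M * n)) : Set (Site 3)) x' y' ∧
              ω ∉ openConnIn (↑(box 3 (4 * M * n)) : Set (Site 3)) x x'} < ε := by
    set f := fun p : unitInterval =>
      (bondPercolation (zdGraph 3) p).real
          {ω | ¬ ∃ x ∈ box 3 n, ∃ y ∈ innerBoundary (zdGraph 3) (box 3 (16 * M * n)),
            ω ∈ openConnIn (↑(box 3 (16 * M * n)) : Set (Site 3)) x y} +
        (bondPercolation (zdGraph 3) p).real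
          {ω | ∃ x ∈ box 3 (4 * n), ∃ x' ∈ box 3 (4 * n),
            ∃ y ∈ innerBoundary (zdGraph 3) (box 3 (4 * M * n)),
            ∃ y' ∈ innerBoundary (zdGraph 3) (box 3 (4 * M * n)),
              ω ∈ openConnIn (↑(box 3 (4 * M * n)) : Set (Site 3)) x y ∧
              ω ∈ openConnIn (↑(box 3 (4 * M * n)) : Set (Site 3)) x' y' ∧
              ω ∉ openConnIn (↑(box 3 (4 * M * n)) : Set (Site 3)) x x'} with hf
    have hcont : Continuous f := Dichotomy.continuous_sum n (16 * M * n) (4 * n) (4 * M * n)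
    set p₀ : unitInterval := criticalProbI 3 with hp₀
    have hlt' : f p₀ < ε := not_le.1 hlt
    have hp₀0 : 0 < (p₀ : ℝ) := by
      rw [hp₀, coe_criticalProbI]; exact criticalProb_zd_pos 3 (by norm_num)
    have hp₀1 : (p₀ : ℝ) ≤ 1 := p₀.2.2
    obtain ⟨δ, hδ, hδf⟩ := Metric.continuous_iff.1 hcont p₀ (ε - f p₀) (sub_pos.2 hlt')
    set q : ℝ := max ((p₀ : ℝ) - δ / 2) ((p₀ : ℝ) / 2) with hq
    have hq0 : q < (p₀ : ℝ) := max_lt (by linarith) (by linarith)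
    have hq01 : q ∈ unitInterval := ⟨le_trans (by linarith) (le_max_right _ _), by linarith⟩
    have hdist : dist (⟨q, hq01⟩ : unitInterval) p₀ < δ := by
      rw [Subtype.dist_eq, Real.dist_eq]
      show |q - (p₀ : ℝ)| < δ
      rw [abs_of_neg (sub_neg.2 hq0)]
      have : (p₀ : ℝ) - δ / 2 ≤ q := le_max_left _ _
      linarith
    have hfq := hδf ⟨q, hq01⟩ hdist
    rw [Real.dist_eq] at hfq
    exact ⟨⟨q, hq01⟩, hq0, by linarith [(abs_lt.1 hfq).2]⟩
  have hθ : 0 < theta (zdGraph 3) (0 : Site 3) p := hεM p n hn hpε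
  have hθ0 : theta (zdGraph 3) (0 : Site 3) p = 0 :=
    theta_eq_zero_of_lt_criticalProb_holds (zdGraph 3) (0 : Site 3) p (by rwa [coe_criticalProbI] at hp)
  exact absurd hθ0 hθ.ne'

/-- **The critical two-cluster dichotomy at every bounded aspect, unconditionally** (vdBvE Lemma 6 at
`p_c(ℤ³)`): for every `M ≥ 1` there is `ε > 0` with
`ε ≤ P_{p_c}(Λ(n) ↮ ∂ⁱⁿΛ(16Mn) in Λ(16Mn)) + P_{p_c}(A₂(4n, 4Mn))` for all `n ≥ 1`
(`twoCluster_dichotomy` with its hypothesis discharged by the landed `gluedCriterion`).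
[cite: VandenbergVanengelenburg2022, Lemma 6] -/
theorem critTwoCluster_dichotomy : ∀ M : ℕ, 1 ≤ M → ∃ ε : ℝ, 0 < ε ∧ ∀ n : ℕ, 1 ≤ n →
    ε ≤ (bondPercolation (zdGraph 3) (criticalProbI 3)).real
        {ω | ¬ ∃ x ∈ box 3 n, ∃ y ∈ innerBoundary (zdGraph 3) (box 3 (16 * M * n)),
          ω ∈ openConnIn (↑(box 3 (16 * M * n)) : Set (Site 3)) x y} +
      (bondPercolation (zdGraph 3) (criticalProbI 3)).real
        {ω | ∃ x ∈ box 3 (4 * n), ∃ x' ∈ box 3 (4 * n),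
          ∃ y ∈ innerBoundary (zdGraph 3) (box 3 (4 * M * n)),
          ∃ y' ∈ innerBoundary (zdGraph 3) (box 3 (4 * M * n)),
            ω ∈ openConnIn (↑(box 3 (4 * M * n)) : Set (Site 3)) x y ∧
            ω ∈ openConnIn (↑(box 3 (4 * M * n)) : Set (Site 3)) x' y' ∧
            ω ∉ openConnIn (↑(box 3 (4 * M * n)) : Set (Site 3)) x x'} :=
  twoCluster_dichotomy gluedCriterion

end Summit.CriticalPhenomena.PercolationContinuityZ3.Theorems.NearLinearTwoClusterDecay.Negative

end
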